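import Summits.ABC.ABC.Theses.TwoSixPencil
import HarnessLib

/-!
# Route `TwoSixPencil` — item `Assembly` (stmt-ABC-24786)

`Assembly := PencilBound → TwoSixDictionary → TwoSixPayoff → TwoSixResidual → ABC` is literally
the planner's deciding theorem `closes` of the route file (pure logic: `h₄ (h₃ h₁ h₂)`).
Cell `abc-harv`, seat pr-4.

HONESTY. Content-free bookkeeping. The mathematical content of the line is the class theorem
`TwoSixClassEpsShape` (stmt-ABC-24781, closed by `twoSixClassEpsShape_proof`: ε-shape 1/6 on the
ℤ/2 × ℤ/6 family) and the general pencil theorem `PencilBound` (stmt-ABC-24782); the last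
hypothesis `TwoSixResidual` is the DECLARED residual of summit strength (= abc off the class), not
claimed and never staffed. Landing this implication proves nothing about abc, A-PS
(«NOT abc — POLY-SZPIRO(E)») or A1′; it moves no rung of LADDER-ABC.
-/

-- `Summit.<Summit>.<Problem>` is the mandated summit-side namespace (CONVENTIONS §2); for the
-- single-conjunct summit `ABC` the two coincide, so the duplicate `ABC.ABC` is deliberate.
set_option linter.dupNamespace false

namespace Summit.ABC.ABC.Theorems

/-- **Closes stmt-ABC-24786** (item `Assembly` of route `TwoSixPencil`):
`PencilBound → TwoSixDictionary → TwoSixPayoff → TwoSixResidual → ABC`, by the route's own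
`closes` (pure logic). Content-free; NOT abc, NOT A-PS, NOT A1′ — the residual hypothesis is
declared, not discharged. [folklore] -/
theorem twoSixPencil_assembly_proof :
    Summit.ABC.ABC.Theses.TwoSixPencil.Assembly :=
  fun h₁ h₂ h₃ h₄ => Summit.ABC.ABC.Theses.TwoSixPencil.closes h₁ h₂ h₃ h₄

end Summit.ABC.ABC.Theorems
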